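import Summits.HubbardSuperconductivity.HubbardSuperconductivity.Theorems.BalabanIRBirBdGPhaseCoercivityLyapunovBond

/-!
# Route BalabanIR — crux 4R `BirGappedPhaseReductionR` (item `stmt-HubbardSuperconductivity-14846`),
# line `chirality-sheet-peierls`, static input (W): chirality-wall coercivity — symbols and lattice sums

Bookkeeping for the proof of the card's first lemma `BdGChiralityWallCoercivity` (Sketch §B of
ideator 2, Cruxes/BirGappedPhaseReductionR): the `d+id` pairing stencil is SPLIT into its
`d_{x²-y²}` part (symbol `A_k = 2Δ₁(cos p₀ - cos p₁)`, real) and its `d_{xy}` part (symbol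
`B_k = -4iΔ₂ sin p₀ sin p₁`, imaginary), because a chirality texture `σ` multiplies only the latter
(by the bond average `(s_x + s_y)/2`, `s = ±1`). This file supplies

* scalar lemmas (vanishing cross terms `Re(conj a · b) = 0 ⇒ |a + b|² = |a|² + |b|²`, the bound
  `|a|² + |b|² ≥ ½ (Im(a + b))²`, and the imaginary part of `B_k/E_k · 2cos q`);
* the two symbols (`torusFourier_dWaveVec`, `torusFourier_dxyVec`, from crux 3's `torusFourier_pairVec`);
* the indicator sum over the four DIAGONAL neighbours `x ± (e₀+e₁)`, `x ± (e₀-e₁)` (distinct for `L ≥ 3`);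
* the exact lattice sum `Σ_k sin² p₀ sin² p₁ = L²/4` (`L ≥ 3`, aliasing-free orthogonality);
* the reflection `p₀ ↦ -p₀` of one lattice momentum (`cos` even, `sin` odd);
* the structured form `circulant(dv₁) + ½(diag s · circulant(dv₂) + circulant(dv₂) · diag s)` of the
  chirality pairing matrix at zero phase texture (and `circulant(dv)` at `σ ≡ true`).

References: S. Friedli, Y. Velenik, *Statistical Mechanics of Lattice Systems* (CUP 2017), §10.4;
crux 3 files `…BdGPhaseCoercivity{Stencils,Symbols,TrigPoly,LyapunovBond}`. No definition is introduced.
-/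

noncomputable section



namespace Summit.HubbardSuperconductivity.HubbardSuperconductivity.Theorems

namespace BirChirality

open Matrix Finset Literature.Probability.LatticeModels
open Summit.HubbardSuperconductivity.HubbardSuperconductivity.Theorems.BirBdG
open scoped ComplexConjugate

variable {L : ℕ} [NeZero L]

/-! ### Scalar lemmas -/

omit [NeZero L] in
/-- A complex number with `conj z = -z` has zero real part. [folklore] -/
theorem re_eq_zero_of_conj_eq_neg {z : ℂ} (h : conj z = -z) : z.re = 0 := by
  have := congrArg Complex.re h
  rw [Complex.conj_re, Complex.neg_re] at this
  linarith

omit [NeZero L] in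
/-- Pythagoras with a vanishing cross term: `‖a + b‖² = ‖a‖² + ‖b‖²` if `Re (conj a · b) = 0`. [folklore] -/
theorem normSq_add_of_re (a b : ℂ) (h : (conj a * b).re = 0) : ‖a + b‖ ^ 2 = ‖a‖ ^ 2 + ‖b‖ ^ 2 := by
  have hab : (a * conj b).re = (conj a * b).re := by
    rw [← Complex.conj_re (a * conj b), map_mul, Complex.conj_conj]
  rw [Complex.sq_norm, Complex.sq_norm, Complex.sq_norm, Complex.normSq_add, hab, h, mul_zero, add_zero]

omit [NeZero L] in
/-- `|a|² + |b|² ≥ ½ (Im (a + b))²`. [folklore] -/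
theorem normSq_add_normSq_ge_im (a b : ℂ) : (a + b).im ^ 2 / 2 ≤ ‖a‖ ^ 2 + ‖b‖ ^ 2 := by
  have h1 : |(a + b).im| ≤ ‖a + b‖ := Complex.abs_im_le_norm _
  have h2 : ‖a + b‖ ≤ ‖a‖ + ‖b‖ := norm_add_le a b
  have h3 : (a + b).im ^ 2 ≤ (‖a‖ + ‖b‖) ^ 2 := by
    rw [← sq_abs]
    exact pow_le_pow_left₀ (abs_nonneg _) (h1.trans h2) 2
  nlinarith [norm_nonneg a, norm_nonneg b, sq_nonneg (‖a‖ - ‖b‖)]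

omit [NeZero L] in
/-- Imaginary part of `B_k/E_k · 2cos q` for `B_k = -4i t`: `-8 t cos q / E`. [folklore] -/
theorem im_dxy_mode (t E c : ℝ) :
    (-(4 * Complex.I * (t : ℂ)) / (E : ℂ) * ((2 * c : ℝ) : ℂ)).im = -(8 * t * c / E) := by
  have : -(4 * Complex.I * (t : ℂ)) / (E : ℂ) * ((2 * c : ℝ) : ℂ) = ((-(8 * t * c / E) : ℝ) : ℂ) * Complex.I := by
    push_cast
    ring
  rw [this, Complex.im_ofReal_mul, Complex.I_im, mul_one]

/-! ### Symbols of the split pairing stencil -/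

/-- **Symbol of the `d_{x²-y²}` part of the pairing stencil** (`L ≥ 3`): `A_k = 2Δ₁(cos p₀ - cos p₁)`. [cite: FriedliVelenik2017, §10.4] -/
theorem torusFourier_dWaveVec (hL : 3 ≤ L) (Δ₁ : ℝ) (k : TorusSite 2 L) :
    torusFourier (fun r : TorusSite 2 L =>
        (Δ₁ : ℂ) * ((if (r = -![1, 0] ∨ r = -![-1, 0]) then (1 : ℂ) else 0) -
            (if (r = -![0, 1] ∨ r = -![0, -1]) then (1 : ℂ) else 0))) k =
      ((2 * Δ₁ * (Real.cos (latticeMomentum L k 0) - Real.cos (latticeMomentum L k 1)) : ℝ) : ℂ) := by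
  have h := torusFourier_pairVec hL Δ₁ 0 k
  have hfun : (fun r : TorusSite 2 L =>
        (Δ₁ : ℂ) * ((if (r = -![1, 0] ∨ r = -![-1, 0]) then (1 : ℂ) else 0) -
            (if (r = -![0, 1] ∨ r = -![0, -1]) then (1 : ℂ) else 0))) =
      (fun r : TorusSite 2 L =>
        (Δ₁ : ℂ) * ((if (r = -![1, 0] ∨ r = -![-1, 0]) then (1 : ℂ) else 0) -
            (if (r = -![0, 1] ∨ r = -![0, -1]) then (1 : ℂ) else 0)) +
          Complex.I * ((0 : ℝ) : ℂ) * ((if (r = -![1, 1] ∨ r = -![-1, -1]) then (1 : ℂ) else 0) -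
            (if (r = -![1, -1] ∨ r = -![-1, 1]) then (1 : ℂ) else 0))) := by
    funext r
    push_cast
    ring
  rw [hfun, h]
  push_cast
  ring

/-- **Symbol of the `d_{xy}` part of the pairing stencil** (`L ≥ 3`): `B_k = -4iΔ₂ sin p₀ sin p₁`. [cite: FriedliVelenik2017, §10.4] -/
theorem torusFourier_dxyVec (hL : 3 ≤ L) (Δ₂ : ℝ) (k : TorusSite 2 L) :
    torusFourier (fun r : TorusSite 2 L =>
        Complex.I * (Δ₂ : ℂ) * ((if (r = -![1, 1] ∨ r = -![-1, -1]) then (1 : ℂ) else 0) -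
            (if (r = -![1, -1] ∨ r = -![-1, 1]) then (1 : ℂ) else 0))) k =
      -(4 * Complex.I * ((Δ₂ * Real.sin (latticeMomentum L k 0) * Real.sin (latticeMomentum L k 1) : ℝ) : ℂ)) := by
  have h := torusFourier_pairVec hL 0 Δ₂ k
  have hfun : (fun r : TorusSite 2 L =>
        Complex.I * (Δ₂ : ℂ) * ((if (r = -![1, 1] ∨ r = -![-1, -1]) then (1 : ℂ) else 0) -
            (if (r = -![1, -1] ∨ r = -![-1, 1]) then (1 : ℂ) else 0))) =
      (fun r : TorusSite 2 L =>
        ((0 : ℝ) : ℂ) * ((if (r = -![1, 0] ∨ r = -![-1, 0]) then (1 : ℂ) else 0) -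
            (if (r = -![0, 1] ∨ r = -![0, -1]) then (1 : ℂ) else 0)) +
          Complex.I * (Δ₂ : ℂ) * ((if (r = -![1, 1] ∨ r = -![-1, -1]) then (1 : ℂ) else 0) -
            (if (r = -![1, -1] ∨ r = -![-1, 1]) then (1 : ℂ) else 0))) := by
    funext r
    push_cast
    ring
  rw [hfun, h]
  push_cast
  ring

/-! ### The four diagonal neighbours -/

omit [NeZero L] in
/-- Indicator of a four-fold disjunction of exclusive point conditions splits into four indicators. [folklore] -/
theorem ite_or_four {α : Type*} [DecidableEq α] (y p₁ p₂ p₃ p₄ : α) (h12 : p₁ ≠ p₂) (h13 : p₁ ≠ p₃)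
    (h14 : p₁ ≠ p₄) (h23 : p₂ ≠ p₃) (h24 : p₂ ≠ p₄) (h34 : p₃ ≠ p₄) (c : ℝ) :
    (if (y = p₁ ∨ y = p₂ ∨ y = p₃ ∨ y = p₄) then c else 0) =
      (if y = p₁ then c else 0) + (if y = p₂ then c else 0) + (if y = p₃ then c else 0) +
        (if y = p₄ then c else 0) := by
  by_cases h1 : y = p₁
  · subst h1; simp [h12, h13, h14]
  · by_cases h2 : y = p₂
    · subst h2; simp [h1, h23, h24]
    · by_cases h3 : y = p₃
      · subst h3; simp [h1, h2, h34]
      · by_cases h4 : y = p₄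
        · subst h4; simp [h1, h2, h3]
        · simp [h1, h2, h3, h4]

/-- For `L ≥ 3` the four diagonal neighbours `x ± (e₀+e₁)`, `x ± (e₀-e₁)` are distinct, so the
indicator sum over them is a sum of four terms. [folklore] -/
theorem sum_ite_diag_eq (hL : 3 ≤ L) (x : TorusSite 2 L) (g : TorusSite 2 L → ℝ) :
    ∑ y, (if (y = x + ![1, 1] ∨ y = x + ![-1, -1] ∨ y = x + ![1, -1] ∨ y = x + ![-1, 1]) then g y else 0) =
      g (x + (Pi.single 0 1 + Pi.single 1 1)) + g (x + -(Pi.single 0 1 + Pi.single 1 1)) +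
        g (x + (Pi.single 0 1 - Pi.single 1 1)) + g (x + -(Pi.single 0 1 - Pi.single 1 1)) := by
  simp only [vec_neg11, vec_neg1m1, vec11_eq, vec1m1_eq]
  -- distinctness of the four shifted points
  have hd := neg_diag_ne_diag (L := L) hL
  have ha := neg_antidiag_ne_antidiag (L := L) hL
  have hda := not_diag_and_antidiag hL (Pi.single 0 1 + Pi.single 1 1 : TorusSite 2 L)
  have hnda := not_diag_and_antidiag hL (-(Pi.single 0 1 + Pi.single 1 1) : TorusSite 2 L)
  simp only [or_true, true_and, not_or, true_or] at hda hnda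
  have e : ∀ v w : TorusSite 2 L, x + v ≠ x + w ↔ v ≠ w := fun v w => by
    rw [Ne, Ne, add_right_inj]
  have hsum : ∀ y : TorusSite 2 L,
      (if (y = x + (Pi.single 0 1 + Pi.single 1 1) ∨ y = x + -(Pi.single 0 1 + Pi.single 1 1) ∨
          y = x + (Pi.single 0 1 - Pi.single 1 1) ∨ y = x + -(Pi.single 0 1 - Pi.single 1 1)) then g y else 0) =
        (if y = x + (Pi.single 0 1 + Pi.single 1 1) then g y else 0) +
          (if y = x + -(Pi.single 0 1 + Pi.single 1 1) then g y else 0) +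
          (if y = x + (Pi.single 0 1 - Pi.single 1 1) then g y else 0) +
          (if y = x + -(Pi.single 0 1 - Pi.single 1 1) then g y else 0) := by
    intro y
    refine ite_or_four y _ _ _ _ ((e _ _).2 hd.symm) ((e _ _).2 hda.2) ((e _ _).2 hda.1)
      ((e _ _).2 hnda.2) ((e _ _).2 hnda.1) ((e _ _).2 ha.symm) (g y)
  simp_rw [hsum, Finset.sum_add_distrib, Finset.sum_ite_eq' Finset.univ, Finset.mem_univ, if_true]

/-! ### Lattice trigonometric sums -/

/-- Aliasing-free orthogonality: `Σ_k cos(ρ₀ p₀ + ρ₁ p₁) = 0` for an integer frequency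
`0 ≠ ρ` with `|ρᵢ| < L`. [cite: FriedliVelenik2017, §10.4] -/
theorem sum_cos_intFreq (ρ : ℤ × ℤ) (hρ : ρ ≠ 0) (h0 : |ρ.1| < L) (h1 : |ρ.2| < L) :
    ∑ k : TorusSite 2 L, Real.cos (ρ.1 * latticeMomentum L k 0 + ρ.2 * latticeMomentum L k 1) = 0 := by
  have hs := sum_torusChar_intFreq (L := L) ρ h0 h1
  rw [if_neg hρ] at hs
  have hre := congrArg Complex.re hs
  rw [Complex.re_sum, Complex.zero_re] at hre
  rw [← hre]
  refine Finset.sum_congr rfl fun k _ => ?_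
  rw [torusChar_intFreq_eq_exp, mul_comm Complex.I, Complex.exp_ofReal_mul_I_re]

/-- **The exact lattice sum** `Σ_k sin² p₀ sin² p₁ = L²/4` for `L ≥ 3`. [cite: FriedliVelenik2017, §10.4] -/
theorem sum_sin_sq_mul_sin_sq (hL : 3 ≤ L) :
    ∑ k : TorusSite 2 L, Real.sin (latticeMomentum L k 0) ^ 2 * Real.sin (latticeMomentum L k 1) ^ 2 =
      ((L ^ 2 : ℕ) : ℝ) / 4 := by
  obtain ⟨s20, s02, -, -⟩ := lyap_trig_sums (L := L) hL
  have h22 := sum_cos_intFreq (L := L) (2, 2) (by simp) (by simp only; rw [abs_two]; omega)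
    (by simp only; rw [abs_two]; omega)
  have h2m2 := sum_cos_intFreq (L := L) (2, -2) (by simp) (by simp only; rw [abs_two]; omega)
    (by simp only [abs_neg]; rw [abs_two]; omega)
  simp only [Int.cast_ofNat, Int.cast_neg] at h22 h2m2
  have hterm : ∀ k : TorusSite 2 L,
      Real.sin (latticeMomentum L k 0) ^ 2 * Real.sin (latticeMomentum L k 1) ^ 2 =
        1 / 4 - Real.cos (2 * latticeMomentum L k 0) / 4 - Real.cos (2 * latticeMomentum L k 1) / 4 +
          (Real.cos (2 * latticeMomentum L k 0 + 2 * latticeMomentum L k 1) +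
            Real.cos (2 * latticeMomentum L k 0 + -2 * latticeMomentum L k 1)) / 8 := by
    intro k
    rw [Real.sin_sq_eq_half_sub, Real.sin_sq_eq_half_sub, Real.cos_add, Real.cos_add,
      show -2 * latticeMomentum L k 1 = -(2 * latticeMomentum L k 1) by ring, Real.cos_neg, Real.sin_neg]
    ring
  rw [Finset.sum_congr rfl fun k _ => hterm k, Finset.sum_add_distrib, Finset.sum_sub_distrib,
    Finset.sum_sub_distrib, ← Finset.sum_div, ← Finset.sum_div, ← Finset.sum_div, ← Finset.sum_div,
    Finset.sum_add_distrib, s20, s02, h22, h2m2, Finset.sum_const, Finset.card_univ, Fintype.card_fun,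
    ZMod.card, Fintype.card_fin]
  push_cast
  ring

/-! ### Reflection of one lattice momentum -/

/-- `cos (2π (-a).val / L) = cos (2π a.val / L)` on `ℤ/L`. [folklore] -/
theorem cos_two_pi_neg_val (a : ZMod L) :
    Real.cos (2 * Real.pi * (((-a).val : ℕ) : ℝ) / L) = Real.cos (2 * Real.pi * ((a.val : ℕ) : ℝ) / L) := by
  rw [ZMod.neg_val]
  split_ifs with h
  · rw [h, ZMod.val_zero]
  · have hL : (L : ℝ) ≠ 0 := by exact_mod_cast NeZero.ne L
    rw [Nat.cast_sub (ZMod.val_lt _).le,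
      show 2 * Real.pi * ((L : ℝ) - ((a.val : ℕ) : ℝ)) / L = 2 * Real.pi - 2 * Real.pi * ((a.val : ℕ) : ℝ) / L by
        field_simp,
      Real.cos_two_pi_sub]

/-- `sin (2π (-a).val / L) = -sin (2π a.val / L)` on `ℤ/L`. [folklore] -/
theorem sin_two_pi_neg_val (a : ZMod L) :
    Real.sin (2 * Real.pi * (((-a).val : ℕ) : ℝ) / L) = -Real.sin (2 * Real.pi * ((a.val : ℕ) : ℝ) / L) := by
  rw [ZMod.neg_val]
  split_ifs with h
  · rw [h, ZMod.val_zero]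
    simp
  · have hL : (L : ℝ) ≠ 0 := by exact_mod_cast NeZero.ne L
    rw [Nat.cast_sub (ZMod.val_lt _).le,
      show 2 * Real.pi * ((L : ℝ) - ((a.val : ℕ) : ℝ)) / L = 2 * Real.pi - 2 * Real.pi * ((a.val : ℕ) : ℝ) / L by
        field_simp,
      Real.sin_two_pi_sub]

omit [NeZero L] in
/-- The reflection `k ↦ (-k₀, k₁)` of `(ℤ/L)²` is an involution. [folklore] -/
theorem reflect0_involutive :
    Function.Involutive (fun k : TorusSite 2 L => Function.update k 0 (-(k 0))) := by
  intro k
  ext i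
  by_cases hi : i = 0
  · subst hi
    simp
  · simp [hi]

/-- Under the reflection `k ↦ (-k₀, k₁)`: `cos p₀`, `cos p₁`, `sin p₁` are unchanged and `sin p₀`
changes sign. [folklore] -/
theorem trig_reflect0 (k : TorusSite 2 L) :
    Real.cos (latticeMomentum L (Function.update k 0 (-(k 0))) 0) = Real.cos (latticeMomentum L k 0) ∧
    Real.sin (latticeMomentum L (Function.update k 0 (-(k 0))) 0) = -Real.sin (latticeMomentum L k 0) ∧
    latticeMomentum L (Function.update k 0 (-(k 0))) 1 = latticeMomentum L k 1 := by
  refine ⟨?_, ?_, ?_⟩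
  · simp only [latticeMomentum, Function.update_self]
    exact cos_two_pi_neg_val (k 0)
  · simp only [latticeMomentum, Function.update_self]
    exact sin_two_pi_neg_val (k 0)
  · simp only [latticeMomentum, Function.update_of_ne (by decide : (1 : Fin 2) ≠ 0)]

/-! ### The structured form of the chirality pairing matrix -/

/-- The chirality pairing matrix at zero phase texture is
`circulant(dv₁) + ½ (diag s · circulant(dv₂) + circulant(dv₂) · diag s)`, `s_x = ±1`. [folklore] -/
theorem chirality_pairing_eq (Δ₁ Δ₂ : ℝ) (σ : TorusSite 2 L → Bool) :
    (fun x y : TorusSite 2 L =>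
        ((Δ₁ : ℂ) * ((if (y = x + ![1, 0] ∨ y = x + ![-1, 0]) then (1 : ℂ) else 0) -
            (if (y = x + ![0, 1] ∨ y = x + ![0, -1]) then (1 : ℂ) else 0)) +
          Complex.I * (Δ₂ : ℂ) * ((if (y = x + ![1, 1] ∨ y = x + ![-1, -1]) then (1 : ℂ) else 0) -
            (if (y = x + ![1, -1] ∨ y = x + ![-1, 1]) then (1 : ℂ) else 0)) *
            (((if σ x then (1 : ℂ) else -1) + (if σ y then (1 : ℂ) else -1)) / 2)) *
        (Complex.exp (Complex.I * ((0 : ℝ) : ℂ)) + Complex.exp (Complex.I * ((0 : ℝ) : ℂ))) / 2 :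
        Matrix (TorusSite 2 L) (TorusSite 2 L) ℂ) =
      Matrix.circulant (fun r : TorusSite 2 L =>
        (Δ₁ : ℂ) * ((if (r = -![1, 0] ∨ r = -![-1, 0]) then (1 : ℂ) else 0) -
            (if (r = -![0, 1] ∨ r = -![0, -1]) then (1 : ℂ) else 0))) +
        (1 / 2 : ℂ) • (Matrix.diagonal (fun x => if σ x then (1 : ℂ) else -1) *
            Matrix.circulant (fun r : TorusSite 2 L =>
              Complex.I * (Δ₂ : ℂ) * ((if (r = -![1, 1] ∨ r = -![-1, -1]) then (1 : ℂ) else 0) -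
                (if (r = -![1, -1] ∨ r = -![-1, 1]) then (1 : ℂ) else 0))) +
          Matrix.circulant (fun r : TorusSite 2 L =>
              Complex.I * (Δ₂ : ℂ) * ((if (r = -![1, 1] ∨ r = -![-1, -1]) then (1 : ℂ) else 0) -
                (if (r = -![1, -1] ∨ r = -![-1, 1]) then (1 : ℂ) else 0))) *
            Matrix.diagonal (fun x => if σ x then (1 : ℂ) else -1)) := by
  ext x y
  rw [Matrix.add_apply, Matrix.smul_apply, Matrix.add_apply, Matrix.diagonal_mul, Matrix.mul_diagonal]
  simp only [Matrix.circulant_apply, eq_add_iff_sub_eq_neg x y, smul_eq_mul, Complex.ofReal_zero, mul_zero,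
    Complex.exp_zero]
  ring

omit [NeZero L] in
/-- At `σ ≡ true` the chirality pairing matrix is crux 3's reference `circulant(d+id stencil)`. [folklore] -/
theorem chirality_pairing_true_eq (Δ₁ Δ₂ : ℝ) :
    (fun x y : TorusSite 2 L =>
        ((Δ₁ : ℂ) * ((if (y = x + ![1, 0] ∨ y = x + ![-1, 0]) then (1 : ℂ) else 0) -
            (if (y = x + ![0, 1] ∨ y = x + ![0, -1]) then (1 : ℂ) else 0)) +
          Complex.I * (Δ₂ : ℂ) * ((if (y = x + ![1, 1] ∨ y = x + ![-1, -1]) then (1 : ℂ) else 0) -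
            (if (y = x + ![1, -1] ∨ y = x + ![-1, 1]) then (1 : ℂ) else 0)) *
            (((if true then (1 : ℂ) else -1) + (if true then (1 : ℂ) else -1)) / 2)) *
        (Complex.exp (Complex.I * ((0 : ℝ) : ℂ)) + Complex.exp (Complex.I * ((0 : ℝ) : ℂ))) / 2 :
        Matrix (TorusSite 2 L) (TorusSite 2 L) ℂ) =
      Matrix.circulant (fun r : TorusSite 2 L =>
        (Δ₁ : ℂ) * ((if (r = -![1, 0] ∨ r = -![-1, 0]) then (1 : ℂ) else 0) -
            (if (r = -![0, 1] ∨ r = -![0, -1]) then (1 : ℂ) else 0)) +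
          Complex.I * (Δ₂ : ℂ) * ((if (r = -![1, 1] ∨ r = -![-1, -1]) then (1 : ℂ) else 0) -
            (if (r = -![1, -1] ∨ r = -![-1, 1]) then (1 : ℂ) else 0))) := by
  ext x y
  simp only [Matrix.circulant_apply, eq_add_iff_sub_eq_neg x y, if_true, Complex.ofReal_zero, mul_zero,
    Complex.exp_zero]
  ring

end BirChirality

/-! ### Registered sub-goal of the crux item (line `chirality-sheet-peierls`, stub W) -/

/-- **The exact lattice sum `Σ_k sin² p₀ sin² p₁ = L²/4`** (`L ≥ 3`) — the normalisation of the
`d_xy` pair amplitude in the chirality-wall bound; registered sub-goal `chiralityLatticeSumSinSq` of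
item stmt-HubbardSuperconductivity-14846 (wrapper of `BirChirality.sum_sin_sq_mul_sin_sq`). [cite: FriedliVelenik2017, §10.4] -/
theorem chiralityLatticeSumSinSq : ∀ (L : ℕ) [NeZero L], 3 ≤ L → ∑ k : Literature.Probability.LatticeModels.TorusSite 2 L, Real.sin (Literature.Probability.LatticeModels.latticeMomentum L k 0) ^ 2 * Real.sin (Literature.Probability.LatticeModels.latticeMomentum L k 1) ^ 2 = ((L ^ 2 : ℕ) : ℝ) / 4 :=
  fun _ _ hL => BirChirality.sum_sin_sq_mul_sin_sq hL

end Summit.HubbardSuperconductivity.HubbardSuperconductivity.Theorems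

end
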